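import Mathlib
import HarnessLib
import Literature.AlgebraicGeometry.Ramification.InertiaNormalSylow
import Literature.AlgebraicGeometry.Resolution.BlowupStalkCharts
import Literature.AlgebraicGeometry.Resolution.BlowupChartQuasiRegular
import Literature.AlgebraicGeometry.Resolution.HilbertSamuelIsolatedSingularities
import Summits.ResolutionOfSingularities.ResolutionOfSingularities.Theorems.WildQuotientsWildQuotientResolutionStubPointBlowupStalkData
import Summits.ResolutionOfSingularities.ResolutionOfSingularities.Theorems.WildQuotientsWildQuotientResolutionChartResidueField

/-!
# Point moves on threefolds create no curves of non-p-closed inertia: over a blown-up closed point, a point with a residue extension is p-closed (crux `WildQuotients.WildQuotientResolution`)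

Crux stmt-ResolutionOfSingularities-15640 (`WildQuotientResolution`), registered stub
`stub_phaseZeroHighDim`, move-game track (`…PointMove` p810587). SCHEME-LEVEL form of memo
`PHASE0-DIM3-TERMINATION.md` §1, assembling ✓`PointBlowupStalkData.stub_pointBlowupStalkData`
(the stalk package of the equivariant blow-up of a finite stable set `Z` of closed points),
the tree's chart theorem `IsBlowup.exists_reesChart_stalk` (`𝒪_{X♯,x}` is a localization of a
Rees chart `𝒪_{X′,z}[𝔪/c_j]` at a prime `𝔴`), `eval₂Hom_chartGen_surjective` (the chart ring is
generated by the `(c_i t)/(c_j t)`), and this hand's ✓`ChartResidueField` /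
✓`PointBlowupResidue` / ✓`PointBlowupRankOne`:

**Theorem** (`hasNormalSylow_inertia_of_pointBlowup_of_not_surjective`). Let `π : X♯ → X′` be
the blow-up of the finite closed `G`-stable set `Z` of closed points of the integral locally
Noetherian `X′` (`G` finite, faithful, over the affine `q`, action lifted to `X♯`), `x ∈ X♯` over
`z ∈ Z` with residue characteristics `p`, and suppose `𝔪_z` is generated by THREE elements
(`z` a closed point of a regular THREEFOLD, or any point of embedding dimension `≤ 3`). If the
residue field map `κ(z) → κ(x)` is NOT surjective, the inertia group `I_x` has a normal Sylow
`p`-subgroup. Consequences (dim 3): every point of the exceptional divisor that is not a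
`κ(z)`-rational closed point — in particular the generic point of every CURVE in `E_z ≅ ℙ²_{κ(z)}`
— is p-closed: point moves never create NPC curves, and the NPC points over `z` are
`κ(z)`-rational (the inputs «Phase III is finite» and «towers are κ-rational» of memo §2–§3).

[OURS · crux stmt-ResolutionOfSingularities-15640 · helper toward `stub_phaseZeroHighDim`
(threefold Phase 0); folklore, counted 0; AI-level work, weaker than expert review.]
-/

-- single-problem summit: the doubled namespace component `ResolutionOfSingularities` is forced
set_option linter.dupNamespace false

namespace Summit.ResolutionOfSingularities.ResolutionOfSingularities.Theorems.WildQuotientResolution.PointMoveNoNpcCurves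

open CategoryTheory AlgebraicGeometry TopologicalSpace IsLocalRing
open Literature.AlgebraicGeometry.Resolution Literature.AlgebraicGeometry.Ramification
open Summit.ResolutionOfSingularities.ResolutionOfSingularities.Theorems.WildQuotientResolution.PointBlowupStalkData
open Summit.ResolutionOfSingularities.ResolutionOfSingularities.Theorems.WildQuotientResolution.ChartResidueField

set_option maxHeartbeats 800000 in
/-- **Over a blown-up closed point of embedding dimension `≤ 3`, a point whose residue field is
not that of the centre has p-closed inertia** (so, on a threefold, point moves create no NPC
curves and NPC points over `z` are `κ(z)`-rational). Setting of
`PointBlowupStalkData.stub_pointBlowupStalkData`; extra hypotheses: `𝔪_z` generated by three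
elements `y₀, y₁, y₂`, residue characteristics `p`, and `κ(z) → κ(x)` (the map of residue fields of
`π♯_x`) not surjective. Proof: the stalk package gives the faithful, compatible, residue-trivial
actions `τ, τ₁` of `I_x`; `IsBlowup.exists_reesChart_stalk` with the generators `y` presents
`𝒪_{X♯,x}` as the localization at a prime `𝔴` of the chart `𝒪_z[𝔪/y_j]`, on which `𝔪_z`
becomes `(y_j)` (`span_image_reesChartBase_eq`) and which is generated by the blow-up coordinates
`(y_i t)/(y_j t)` (`eval₂Hom_chartGen_surjective`, `reesChartBase_apply_eq_mul_chartGen`); then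
✓`hasNormalSylow_of_pointBlowupStep_of_chart`. [folklore] -/
theorem hasNormalSylow_inertia_of_pointBlowup_of_not_surjective (p : ℕ) [Fact p.Prime]
    {X' X₁ : Scheme.{0}} (q : X' ⟶ X₁) [IsAffineHom q]
    {G : Type} [Group G] [Finite G] (ρ : G →* Aut X') (hfaith : Function.Injective ρ)
    (hρ : ∀ g : G, (ρ g).hom ≫ q = q) [IsIntegral X'] [IsLocallyNoetherian X']
    {Z : Set X'} (hZc : IsClosed Z) (hZf : Z.Finite) (hZpt : ∀ z ∈ Z, IsClosed ({z} : Set X'))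
    {Xs : Scheme.{0}} {π : Xs ⟶ X'}
    (hπ : IsBlowup π (Scheme.IdealSheafData.vanishingIdeal ⟨Z, hZc⟩)) [IsIntegral Xs]
    (ρs : G →* Aut Xs) (hequiv : ∀ g : G, (ρs g).hom ≫ π = π ≫ (ρ g).hom)
    (x : Xs) (hx : π.base x ∈ Z)
    [CharP (ResidueField (X'.presheaf.stalk (π.base x))) p]
    [CharP (ResidueField (Xs.presheaf.stalk x)) p]
    (y : Fin 3 → X'.presheaf.stalk (π.base x))
    (hy : Ideal.span (Set.range y) = maximalIdeal (X'.presheaf.stalk (π.base x)))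
    (hκ : ¬ Function.Surjective (ResidueField.map (π.stalkMap x).hom)) :
    HasNormalSylow p (inertiaSubgroup ρs x) := by
  classical
  -- the stalk package: actions `τ`, `τ₁` (the `t` it offers is not used; we take our own chart)
  obtain ⟨τ, τ₁, -, hτ, hcomp, hres, -, -, hιinj⟩ :=
    stub_pointBlowupStalkData q ρ hfaith hρ hZc hZf hZpt hπ ρs hequiv x hx
  -- the Rees chart through `x` for the generators `y` of `𝔪_z = (𝓘_Z)_z`
  have hst : stalkIdeal (Scheme.IdealSheafData.vanishingIdeal ⟨Z, hZc⟩) (π.base x) =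
      maximalIdeal (X'.presheaf.stalk (π.base x)) :=
    stalkIdeal_vanishingIdeal_of_finite (Z := ⟨Z, hZc⟩) hZf hZpt hx
  have hc : Ideal.span (Set.range y) =
      stalkIdeal (Scheme.IdealSheafData.vanishingIdeal ⟨Z, hZc⟩) (π.base x) := hy.trans hst.symm
  obtain ⟨j, 𝔴, χ, hχ, hloc, -⟩ := hπ.exists_reesChart_stalk x y hc
  letI : Algebra (chartRing y j) (Xs.presheaf.stalk x) := χ.toAlgebra
  haveI : IsLocalization.AtPrime (Xs.presheaf.stalk x) 𝔴.asIdeal := hloc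
  -- `t = y_j`: `𝔪_z 𝒪_x = (ι y_j)`
  have hyj : y j ∈ maximalIdeal (X'.presheaf.stalk (π.base x)) :=
    hy ▸ Ideal.subset_span (Set.mem_range_self j)
  have hgen : Ideal.map (π.stalkMap x).hom (maximalIdeal (X'.presheaf.stalk (π.base x))) =
      Ideal.span {(π.stalkMap x).hom (y j)} := by
    have h1 : (Ideal.span (Set.range y)).map (chartBase y j) = Ideal.span {chartBase y j (y j)} :=
      span_image_reesChartBase_eq (y j) _
    have h2 : (π.stalkMap x).hom = χ.comp (chartBase y j) := (RingHom.ext hχ).symm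
    rw [← hy, h2, ← Ideal.map_map, h1, Ideal.map_span, Set.image_singleton, RingHom.comp_apply]
  -- the chart form of the point blow-up step
  refine hasNormalSylow_of_pointBlowupStep_of_chart p (π.stalkMap x).hom hιinj (y j) hyj hgen
    τ τ₁ hτ hcomp hres y hy (chartBase y j) χ hχ 𝔴.asIdeal (fun _ => rfl)
    (fun j' : {j' : Fin 3 // j' ≠ j} => chartGen y j j'.1) (fun b => ?_) (fun j' => ?_) hκ
  · -- generation: `R[T_{j'} : j' ≠ j] → B` is onto
    obtain ⟨P, hP⟩ := eval₂Hom_chartGen_surjective y j b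
    refine ⟨P, ?_⟩
    have hP' : MvPolynomial.eval₂ (chartBase y j)
        (fun j' : {j' : Fin 3 // j' ≠ j} => chartGen y j j'.1) P = b := by
      rw [← MvPolynomial.coe_eval₂Hom]; exact hP
    rw [hP', sub_self]
    exact zero_mem _
  · -- blow-up coordinates: `χ(e_{j'}) · ι(y_j) = ι(y_{j'})`
    refine ⟨y j'.1, hy ▸ Ideal.subset_span (Set.mem_range_self _), ?_⟩
    have h' : chartBase y j (y j'.1) = chartBase y j (y j) * chartGen y j j'.1 :=
      reesChartBase_apply_eq_mul_chartGen y j j'.1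
    rw [← hχ, ← hχ, h', map_mul, mul_comm]

end Summit.ResolutionOfSingularities.ResolutionOfSingularities.Theorems.WildQuotientResolution.PointMoveNoNpcCurves
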